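import Summits.QuantumFields.BalabanUV.Beta.EriceFlowEnclosureSmoothClauseCalc
import Summits.QuantumFields.BalabanUV.Beta.EriceFlowEnclosureTaylorClauseG
import Summits.QuantumFields.BalabanUV.Beta.EriceFlowEnclosureTaylorAllOrdersHolo

/-!
# Beta / EriceFlowEnclosureGClauseCalc — THE LITERAL ROAD (G), PURE SERVICE: the calculus of the substitution u = g² on a closed
# interval `[0, γ]` — Lipschitz IN g² from `C²` data IN g with a vanishing first g-derivative at 0; even g-jets are jets in g²;
# a Taylor expansion in g² is an even Taylor expansion in g; asymptotic letters in g are FORCED, so an all-orders expansion in g²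
# makes every odd g-letter vanish; the order-3 g-jet pinned by a second-order expansion in g²; a quadratic bound at 0 is a
# derivative within the segment
# (β-flow team, prover 2 = lower ∕ positivity side, unit `b2b-balaban-beta-bflow-p2`, gen 25; the calculus behind P2 #42
# `EriceFlowEnclosureGClause`, which reads [Balaban1987RG1] p. 264's clause IN [I]'s OWN VARIABLE g — p. 255 «The action A₁
# determines a function β₁(g₀) of the bare coupling constant g₀, defined on an interval [0, γ], γ > 0.», p. 264 tl.25–27 «It is a
# smooth function defined on the interval [0, γ], (or analytic), uniformly bounded on this interval together with all derivatives.» —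
# where the lineage's roads (H) and (S) read it in g²)

HONEST FRAMING (page 1 of everything the β sub-cell writes): discharging `BetaPertH` makes Bałaban's UV stability UNCONDITIONAL — a
real constructive-QFT result; it is NOT the continuum limit and NOT the Clay problem.  HONEST DEPENDENCY (cell reorg 2026-08-19,
verbatim): «continuum YM on T⁴ ⇐ BetaPertH ∧ nine spine estimates (0/9 proved); BetaPertH ⇐ (D1) ∧ (D4) ∧ CAP+tail; G-an2-4 gates
asym, D1 and NE2/3/4.»  THIS MODULE DISCHARGES NOTHING of that: it is [folklore] one-variable real analysis with NO Erice letter in it;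
P2 #42 applies it to the Markov family `S.βE`.  Callees BY NAME: P2 #41-A `EriceFlowEnclosureSmoothClauseCalc`
(`hasDerivWithinAt_iteratedDerivWithin`, `lipschitz_iteratedDerivWithin_of_succ_bound`), bflow-p1 gen 3 `EriceFlowEnclosureTaylorClauseG`
(`taylorAtZero_of_fourthDerivBound`, `cubic_coeffs_zero` — the order-four ancestor of the g-road), P2 #37e v1.1
`EriceFlowEnclosureTaylorAllOrdersHolo.taylorN_letters_unique` (asymptotic letters are forced).

THE POINT.  A function given in the variable s = g² on `[0, γ²]`, `h`, whose pull-back `f(g) := h(g²)` is smooth on `[0, γ]` with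
bounded g-derivatives, is smooth in s AWAY from 0 but at s = 0 only as regular as the ODD part of f's jet allows (`f(g) = g` gives
`h(s) = √s`).  What survives WITHOUT any parity: nothing beyond Hölder-½ continuity.  With the odd letters of orders 1 (and 3) equal to zero —
which is what Erice's printed (3.73) «β_n(g_n²) = β_{n,0} + β_{n,2}g_n² + O(g_n⁴)» forces, §4 — one gets: `h` is LIPSCHITZ IN s with the
constant of the SECOND g-derivative (§1: `|∂_g f(r)| ≤ B·r` from `∂_g f(0) = 0`, then `|f(g) − f(g′)| ≤ B·g·(g − g′) ≤ B·(g² − g′²)`), and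
the g-Taylor expansion to order `g³` with zero odd letters IS the expansion `h(s) = h(0) + (∂²_g f(0)∕2)·s + O(s²)` (§2–§3).  At every
order: an even g-jet to order `2N+1` is a jet in s to order N (§2 `sum_even_letters`, §3 `sqTaylor_of_even_gTaylor`); conversely a
Taylor expansion in s on a chart is an even expansion in g (`even_gTaylor_of_sqTaylor`), and since asymptotic letters in g are FORCED
(`taylorN_letters_unique`), a function with g-expansions at all orders AND s-expansions at all orders has ALL ODD g-LETTERS ZERO
(§3 `gLetters_even_of_sqTaylorAll`).  §5: a quadratic bound `|β t − β 0 − β₂ t| ≤ C t²` on `[0, r]` is `HasDerivWithinAt β β₂ (Icc 0 r) 0`.  §6 `gPair_of_sqPair`: THE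
READING IN g² IMPLIES THE LITERAL READING — an s-pair on `[0, s₀]` is a g-pair on `[0, √s₀]` (chain rule; bounds by Mathlib's Faà di
Bruno estimate `norm_iteratedFDerivWithin_comp_le`); the converse fails (P2 #42c).
STATUS: [folklore]; 0 def, 0 sorry; no Erice ∕ [I] sentence is used or asserted here.
-/

namespace Summit.QuantumFields.BalabanUV.Beta.EriceFlowEnclosureGClauseCalc

open Filter Set Metric Asymptotics
open scoped Topology Nat ContDiff
open Summit.QuantumFields.BalabanUV.Beta.EriceFlowEnclosureSmoothClauseCalc
  (hasDerivWithinAt_iteratedDerivWithin lipschitz_iteratedDerivWithin_of_succ_bound)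
open Summit.QuantumFields.BalabanUV.Beta.EriceFlowEnclosureTaylorClauseG (taylorAtZero_of_fourthDerivBound cubic_coeffs_zero)
open Summit.QuantumFields.BalabanUV.Beta.EriceFlowEnclosureTaylorAllOrdersHolo (taylorN_letters_unique)

noncomputable section

/-! ## §0 The square root lands in `[0, γ]` -/

/-- `s ∈ [0, γ²]`, `0 ≤ γ` ⟹ `√s ∈ [0, γ]`. [folklore] -/
theorem sqrt_mem_Icc {γ s : ℝ} (hγ : 0 ≤ γ) (hs : s ∈ Icc (0 : ℝ) (γ ^ 2)) : Real.sqrt s ∈ Icc (0 : ℝ) γ :=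
  ⟨Real.sqrt_nonneg s, by rw [← Real.sqrt_sq hγ]; exact Real.sqrt_le_sqrt hs.2⟩

/-- `g ∈ [0, γ]` ⟹ `g² ∈ [0, γ²]`. [folklore] -/
theorem sq_mem_Icc {γ g : ℝ} (hg : g ∈ Icc (0 : ℝ) γ) : g ^ 2 ∈ Icc (0 : ℝ) (γ ^ 2) :=
  ⟨sq_nonneg g, pow_le_pow_left₀ hg.1 hg.2 2⟩

/-! ## §1 Lipschitz IN g² from C² data IN g with ∂_g f(0) = 0 -/

/-- **C² in g on `[0, γ]` with a vanishing first g-derivative at 0 ⟹ Lipschitz in g² with the second-derivative bound.**  If `f` is `C²`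
on `[0, γ]` (`0 < γ`), `∂_g f(0) = 0` and `|∂²_g f| ≤ B` on `[0, γ]` (derivatives within the interval), then
`|f(g) − f(g′)| ≤ B·|g² − g′²|` for all `g, g′ ∈ [0, γ]` — the mean value inequality on `[g′, g]` with the bound `|∂_g f(r)| ≤ B·r ≤ B·g`
(itself the mean value inequality for `∂_g f` from `∂_g f(0) = 0`), and `g·(g − g′) ≤ (g + g′)·(g − g′)`. [folklore] -/
theorem abs_sub_le_mul_abs_sq_sub {f : ℝ → ℝ} {γ B : ℝ} (hγ : 0 < γ) (hf : ContDiffOn ℝ 2 f (Icc (0 : ℝ) γ))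
    (h0 : iteratedDerivWithin 1 f (Icc (0 : ℝ) γ) 0 = 0)
    (hB : ∀ x ∈ Icc (0 : ℝ) γ, |iteratedDerivWithin 2 f (Icc (0 : ℝ) γ) x| ≤ B) :
    ∀ g ∈ Icc (0 : ℝ) γ, ∀ g' ∈ Icc (0 : ℝ) γ, |f g - f g'| ≤ B * |g ^ 2 - g' ^ 2| := by
  have hB0 : 0 ≤ B := (abs_nonneg _).trans (hB 0 ⟨le_rfl, hγ.le⟩)
  have hF : ∀ x ∈ Icc (0 : ℝ) γ, |iteratedDerivWithin 1 f (Icc (0 : ℝ) γ) x| ≤ B * x := by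
    intro x hx
    have h := lipschitz_iteratedDerivWithin_of_succ_bound (m := 1) hγ hf hB x hx 0 ⟨le_rfl, hγ.le⟩
    rw [h0, sub_zero, sub_zero, abs_of_nonneg hx.1] at h
    exact h
  have hder : ∀ x ∈ Icc (0 : ℝ) γ, HasDerivWithinAt f (iteratedDerivWithin 1 f (Icc (0 : ℝ) γ) x) (Icc (0 : ℝ) γ) x := by
    intro x hx
    have hf1 : ContDiffOn ℝ (0 + 1 : ℕ) f (Icc (0 : ℝ) γ) := hf.of_le (by norm_num)
    have h := hasDerivWithinAt_iteratedDerivWithin (m := 0) hγ hf1 x hx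
    rwa [iteratedDerivWithin_zero] at h
  suffices key : ∀ g ∈ Icc (0 : ℝ) γ, ∀ g' ∈ Icc (0 : ℝ) γ, g' ≤ g → |f g - f g'| ≤ B * |g ^ 2 - g' ^ 2| by
    intro g hg g' hg'
    rcases le_total g' g with h | h
    · exact key g hg g' hg' h
    · have h2 := key g' hg' g hg h
      rwa [abs_sub_comm (f g') (f g), abs_sub_comm (g' ^ 2) (g ^ 2)] at h2
  intro g hg g' hg' hle
  have hsub : Icc g' g ⊆ Icc (0 : ℝ) γ := Icc_subset_Icc hg'.1 hg.2
  have hder' : ∀ x ∈ Icc g' g, HasDerivWithinAt f (iteratedDerivWithin 1 f (Icc (0 : ℝ) γ) x) (Icc g' g) x :=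
    fun x hx => (hder x (hsub hx)).mono hsub
  have hbound : ∀ x ∈ Icc g' g, ‖iteratedDerivWithin 1 f (Icc (0 : ℝ) γ) x‖ ≤ B * g := by
    intro x hx
    rw [Real.norm_eq_abs]
    exact (hF x (hsub hx)).trans (mul_le_mul_of_nonneg_left hx.2 hB0)
  have key := (convex_Icc g' g).norm_image_sub_le_of_norm_hasDerivWithin_le hder' hbound
    (left_mem_Icc.mpr hle) (right_mem_Icc.mpr hle)
  rw [Real.norm_eq_abs, Real.norm_eq_abs, abs_of_nonneg (sub_nonneg.mpr hle)] at key
  have hsq : g ^ 2 - g' ^ 2 = (g + g') * (g - g') := by ring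
  have hnn : 0 ≤ g ^ 2 - g' ^ 2 := by rw [hsq]; exact mul_nonneg (by linarith [hg.1, hg'.1]) (sub_nonneg.mpr hle)
  rw [abs_of_nonneg hnn, hsq]
  calc |f g - f g'| ≤ B * g * (g - g') := key
    _ ≤ B * ((g + g') * (g - g')) := by
        have h1 : g * (g - g') ≤ (g + g') * (g - g') :=
          mul_le_mul_of_nonneg_right (by linarith [hg'.1]) (sub_nonneg.mpr hle)
        nlinarith [h1, hB0]

/-- **The same, read in the variable s = g² on `[0, γ²]`.**  If `g ↦ h(g²)` is `C²` on `[0, γ]` (`0 < γ`) with a vanishing first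
g-derivative at 0 and `|∂²_g| ≤ B`, then `|h(s) − h(s′)| ≤ B·|s − s′|` for all `s, s′ ∈ [0, γ²]` (substitute `g = √s`). [folklore] -/
theorem lipschitz_sq_of_gData {h : ℝ → ℝ} {γ B : ℝ} (hγ : 0 < γ)
    (hf : ContDiffOn ℝ 2 (fun g => h (g ^ 2)) (Icc (0 : ℝ) γ))
    (h0 : iteratedDerivWithin 1 (fun g => h (g ^ 2)) (Icc (0 : ℝ) γ) 0 = 0)
    (hB : ∀ x ∈ Icc (0 : ℝ) γ, |iteratedDerivWithin 2 (fun g => h (g ^ 2)) (Icc (0 : ℝ) γ) x| ≤ B) :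
    ∀ s ∈ Icc (0 : ℝ) (γ ^ 2), ∀ s' ∈ Icc (0 : ℝ) (γ ^ 2), |h s - h s'| ≤ B * |s - s'| := by
  intro s hs s' hs'
  have key := abs_sub_le_mul_abs_sq_sub hγ hf h0 hB (Real.sqrt s) (sqrt_mem_Icc hγ.le hs)
    (Real.sqrt s') (sqrt_mem_Icc hγ.le hs')
  simp only [Real.sq_sqrt hs.1, Real.sq_sqrt hs'.1] at key
  exact key

/-! ## §2 Even g-jets are jets in g² -/

/-- **An even polynomial in g is a polynomial in g².**  If the odd letters `c i`, `i < 2N+2`, vanish then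
`Σ_{i < 2N+2} c i·g^i = Σ_{j < N+1} c (2j)·(g²)^j`. [folklore] -/
theorem sum_even_letters {c : ℕ → ℝ} (N : ℕ) (hodd : ∀ i < 2 * N + 2, i % 2 = 1 → c i = 0) (g : ℝ) :
    ∑ i ∈ Finset.range (2 * N + 2), c i * g ^ i = ∑ j ∈ Finset.range (N + 1), c (2 * j) * (g ^ 2) ^ j := by
  induction N with
  | zero =>
    have h1 : c 1 = 0 := hodd 1 (by norm_num) (by norm_num)
    simp [Finset.sum_range_succ, h1]
  | succ N ih =>
    have ih' := ih (fun i hi hio => hodd i (by omega) hio)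
    have hlast : c (2 * N + 3) = 0 := hodd (2 * N + 3) (by omega) (by omega)
    have hL : ∑ i ∈ Finset.range (2 * (N + 1) + 2), c i * g ^ i
        = (∑ i ∈ Finset.range (2 * N + 2), c i * g ^ i) + c (2 * N + 2) * g ^ (2 * N + 2)
          + c (2 * N + 3) * g ^ (2 * N + 3) := by
      rw [show 2 * (N + 1) + 2 = (2 * N + 2) + 1 + 1 by ring, Finset.sum_range_succ, Finset.sum_range_succ]
    have hR : ∑ j ∈ Finset.range (N + 1 + 1), c (2 * j) * (g ^ 2) ^ j
        = (∑ j ∈ Finset.range (N + 1), c (2 * j) * (g ^ 2) ^ j) + c (2 * (N + 1)) * (g ^ 2) ^ (N + 1) :=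
      Finset.sum_range_succ _ _
    rw [hL, hR, ih', hlast, zero_mul, add_zero, ← pow_mul, show 2 * (N + 1) = 2 * N + 2 by ring]

/-- **A Taylor expansion in g with zero odd letters to order `2N+1` is a Taylor expansion in s = g² to order N** (substitute `g = √s`):
`|f(g) − Σ_{i < 2N+2} c i g^i| ≤ C·g^{2N+2}` on `[0, r]` ⟹ `|f(√s) − Σ_{j < N+1} c (2j) s^j| ≤ C·s^{N+1}` on `[0, r²]`. [folklore] -/
theorem sqTaylor_of_even_gTaylor {f : ℝ → ℝ} {c : ℕ → ℝ} {N : ℕ} {C r : ℝ} (hr : 0 ≤ r)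
    (hodd : ∀ i < 2 * N + 2, i % 2 = 1 → c i = 0)
    (hT : ∀ g ∈ Icc (0 : ℝ) r, |f g - ∑ i ∈ Finset.range (2 * N + 2), c i * g ^ i| ≤ C * g ^ (2 * N + 2)) :
    ∀ s ∈ Icc (0 : ℝ) (r ^ 2), |f (Real.sqrt s) - ∑ j ∈ Finset.range (N + 1), c (2 * j) * s ^ j| ≤ C * s ^ (N + 1) := by
  intro s hs
  have h := hT (Real.sqrt s) (sqrt_mem_Icc hr hs)
  rw [sum_even_letters N hodd, Real.sq_sqrt hs.1] at h
  have e : Real.sqrt s ^ (2 * N + 2) = s ^ (N + 1) := by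
    rw [show 2 * N + 2 = 2 * (N + 1) by ring, pow_mul, Real.sq_sqrt hs.1]
  rwa [e] at h

/-- **A Taylor expansion in s on a chart `]0, δ]` is an EVEN Taylor expansion in g on `]0, √δ]`** (letters `c (2j) = b j`, `c (odd) = 0`,
written `c i = if i % 2 = 0 then b (i ∕ 2) else 0`). [folklore] -/
theorem even_gTaylor_of_sqTaylor {β : ℝ → ℝ} {b : ℕ → ℝ} {N : ℕ} {C δ : ℝ}
    (hT : ∀ t ∈ Ioc (0 : ℝ) δ, |β t - ∑ j ∈ Finset.range (N + 1), b j * t ^ j| ≤ C * t ^ (N + 1)) :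
    ∀ g ∈ Ioc (0 : ℝ) (Real.sqrt δ),
      |β (g ^ 2) - ∑ i ∈ Finset.range (2 * N + 2), (if i % 2 = 0 then b (i / 2) else 0) * g ^ i| ≤ C * g ^ (2 * N + 2) := by
  intro g hg
  have hδ : 0 < δ := by
    by_contra h
    have h0 : Real.sqrt δ = 0 := Real.sqrt_eq_zero'.mpr (not_lt.mp h)
    exact absurd (hg.2.trans_eq h0) (not_le.mpr hg.1)
  have hg2 : g ^ 2 ∈ Ioc (0 : ℝ) δ := by
    refine ⟨pow_pos hg.1 2, ?_⟩
    calc g ^ 2 ≤ (Real.sqrt δ) ^ 2 := pow_le_pow_left₀ hg.1.le hg.2 2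
      _ = δ := Real.sq_sqrt hδ.le
  have h := hT (g ^ 2) hg2
  rw [sum_even_letters N (fun i _ hio => by simp [hio]) g]
  have e : ∑ j ∈ Finset.range (N + 1), (if (2 * j) % 2 = 0 then b (2 * j / 2) else 0) * (g ^ 2) ^ j
      = ∑ j ∈ Finset.range (N + 1), b j * (g ^ 2) ^ j := by
    refine Finset.sum_congr rfl fun j _ => ?_
    have h1 : (2 * j) % 2 = 0 := by omega
    have h2 : 2 * j / 2 = j := by omega
    rw [if_pos h1, h2]
  rw [e, show 2 * N + 2 = 2 * (N + 1) by ring, pow_mul]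
  exact h

/-! ## §3 All orders: parity of the g-letters ⟺ expansions in g² -/

/-- **If the odd g-letters vanish at every order, every g-expansion is an s-expansion** (the all-orders form of §2 on a chart `]0, r]`):
`∀ M, |β(g²) − Σ_{i ≤ M} c i g^i| ≤ C_M g^{M+1}` with `c (odd) = 0` ⟹ `∀ N, ∃ C, ∀ t ∈ ]0, r²], |β t − Σ_{j ≤ N} c (2j) t^j| ≤ C t^{N+1}`.
[folklore] -/
theorem sqTaylorAll_of_even_gTaylorAll {β : ℝ → ℝ} {c : ℕ → ℝ} {r : ℝ} (hr : 0 ≤ r) (hodd : ∀ i, i % 2 = 1 → c i = 0)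
    (hg : ∀ M : ℕ, ∃ C, ∀ g ∈ Ioc (0 : ℝ) r, |β (g ^ 2) - ∑ i ∈ Finset.range (M + 1), c i * g ^ i| ≤ C * g ^ (M + 1)) :
    ∀ N : ℕ, ∃ C, ∀ t ∈ Ioc (0 : ℝ) (r ^ 2), |β t - ∑ j ∈ Finset.range (N + 1), c (2 * j) * t ^ j| ≤ C * t ^ (N + 1) := by
  intro N
  obtain ⟨C, hC⟩ := hg (2 * N + 1)
  refine ⟨C, fun t ht => ?_⟩
  have hst : Real.sqrt t ∈ Ioc (0 : ℝ) r :=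
    ⟨Real.sqrt_pos.mpr ht.1, by rw [← Real.sqrt_sq hr]; exact Real.sqrt_le_sqrt ht.2⟩
  have h := hC (Real.sqrt t) hst
  rw [show 2 * N + 1 + 1 = 2 * N + 2 by ring, sum_even_letters N (fun i _ hio => hodd i hio), Real.sq_sqrt ht.1.le] at h
  have e : Real.sqrt t ^ (2 * N + 2) = t ^ (N + 1) := by
    rw [show 2 * N + 2 = 2 * (N + 1) by ring, pow_mul, Real.sq_sqrt ht.1.le]
  rwa [e] at h

/-- **ASYMPTOTIC LETTERS IN g ARE FORCED, SO EXPANSIONS IN g² AT EVERY ORDER MAKE EVERY ODD g-LETTER VANISH.**  If `β(g²)` has an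
asymptotic expansion `Σ c i g^i` at every order on `]0, r]` (`r > 0`) and `β(t)` has an asymptotic expansion `Σ b j t^j` at every order
on `]0, δ]` (`δ > 0`), then `c i = 0` for every odd i and `c (2j) = b j` (P2 #37e v1.1 `taylorN_letters_unique` on the chart
`]0, min r √δ]`, comparing with the even expansion of §2). [folklore] -/
theorem gLetters_even_of_sqTaylorAll {β : ℝ → ℝ} {c b : ℕ → ℝ} {r δ : ℝ} (hr : 0 < r) (hδ : 0 < δ)
    (hg : ∀ M : ℕ, ∃ C, ∀ g ∈ Ioc (0 : ℝ) r, |β (g ^ 2) - ∑ i ∈ Finset.range (M + 1), c i * g ^ i| ≤ C * g ^ (M + 1))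
    (hs : ∀ N : ℕ, ∃ C, ∀ t ∈ Ioc (0 : ℝ) δ, |β t - ∑ j ∈ Finset.range (N + 1), b j * t ^ j| ≤ C * t ^ (N + 1)) :
    (∀ i, i % 2 = 1 → c i = 0) ∧ ∀ j, c (2 * j) = b j := by
  set ρ : ℝ := min r (Real.sqrt δ) with hρ
  have hρpos : 0 < ρ := lt_min hr (Real.sqrt_pos.mpr hδ)
  -- at every order M = 2N+1 the two expansions of g ↦ β(g²) agree letter by letter
  have key : ∀ N : ℕ, ∀ m ≤ 2 * N + 1, c m = (if m % 2 = 0 then b (m / 2) else 0) := by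
    intro N
    obtain ⟨C, hC⟩ := hg (2 * N + 1)
    obtain ⟨C', hC'⟩ := hs N
    have h1 : ∀ g ∈ Ioc (0 : ℝ) ρ, |β (g ^ 2) - ∑ i ∈ Finset.range (2 * N + 1 + 1), c i * g ^ i| ≤ C * g ^ (2 * N + 1 + 1) :=
      fun g hg' => hC g ⟨hg'.1, hg'.2.trans (min_le_left _ _)⟩
    have h2 : ∀ g ∈ Ioc (0 : ℝ) ρ, |β (g ^ 2) - ∑ i ∈ Finset.range (2 * N + 1 + 1),
        (if i % 2 = 0 then b (i / 2) else 0) * g ^ i| ≤ C' * g ^ (2 * N + 1 + 1) := by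
      intro g hg'
      have h := even_gTaylor_of_sqTaylor hC' g ⟨hg'.1, hg'.2.trans (min_le_right _ _)⟩
      rw [show 2 * N + 1 + 1 = 2 * N + 2 by ring]
      exact h
    exact taylorN_letters_unique (β := fun g => β (g ^ 2)) hρpos (2 * N + 1) h1 h2
  refine ⟨fun i hi => ?_, fun j => ?_⟩
  · have h := key i i (by omega)
    rw [h, if_neg (by omega)]
  · have h := key j (2 * j) (by omega)
    rw [h, if_pos (by omega), show 2 * j / 2 = j by omega]

/-! ## §4 The order-3 g-jet pinned by a second-order expansion in g² -/

/-- **A SECOND-ORDER EXPANSION IN g² PINS THE ORDER-3 JET IN g: value, zero, twice the slope, zero.**  If `g ↦ h(g²)` is `C⁴` on `[0, γ]`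
(`0 < γ`) with `|∂⁴_g| ≤ B`, and `|h(s) − (b₀ + b₂ s)| ≤ Cn·s²` for `0 ≤ s ≤ s₃` (`s₃ > 0` — Erice's (3.73) at ONE scale, its own radius
and constant), then `b₀ = h(0)`, `∂_g(h∘sq)(0) = 0`, `∂²_g(h∘sq)(0) = 2b₂`, `∂³_g(h∘sq)(0) = 0` (derivatives within `[0, γ]`): the
order-3 Taylor jet in g (bflow-p1 `taylorAtZero_of_fourthDerivBound`) and the expansion in g² are both `O(g⁴)` on `]0, min γ √s₃]`, and
a cubic dominated by `g⁴` vanishes (bflow-p1 `cubic_coeffs_zero`) — the inner step of bflow-p1 gen 3's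
`taylorSplit373_of_perScale_of_gFourthDerivBound`, isolated with a PER-SCALE radius. [folklore] -/
theorem gJet_of_sqTaylorTwo {h : ℝ → ℝ} {γ B b₀ b₂ Cn s₃ : ℝ} (hγ : 0 < γ) (hs₃ : 0 < s₃)
    (hf : ContDiffOn ℝ 4 (fun g => h (g ^ 2)) (Icc (0 : ℝ) γ))
    (hB : ∀ x ∈ Icc (0 : ℝ) γ, |iteratedDerivWithin 4 (fun g => h (g ^ 2)) (Icc (0 : ℝ) γ) x| ≤ B)
    (h373 : ∀ s : ℝ, 0 ≤ s → s ≤ s₃ → |h s - (b₀ + b₂ * s)| ≤ Cn * s ^ 2) :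
    b₀ = h 0 ∧ iteratedDerivWithin 1 (fun g => h (g ^ 2)) (Icc (0 : ℝ) γ) 0 = 0 ∧
      iteratedDerivWithin 2 (fun g => h (g ^ 2)) (Icc (0 : ℝ) γ) 0 = 2 * b₂ ∧
      iteratedDerivWithin 3 (fun g => h (g ^ 2)) (Icc (0 : ℝ) γ) 0 = 0 := by
  have hT := taylorAtZero_of_fourthDerivBound hγ.le hf hB
  have hb0 : b₀ = h 0 := by
    have h0 : |h 0 - (b₀ + b₂ * 0)| ≤ Cn * 0 ^ 2 := h373 0 le_rfl hs₃.le
    have h0' : |h 0 - b₀| ≤ 0 := by simpa using h0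
    have hz := abs_eq_zero.mp (le_antisymm h0' (abs_nonneg _))
    linarith
  have hr : 0 < min γ (Real.sqrt s₃) := lt_min hγ (Real.sqrt_pos.mpr hs₃)
  set d1 := iteratedDerivWithin 1 (fun g => h (g ^ 2)) (Icc (0 : ℝ) γ) 0 with hd1
  set d2 := iteratedDerivWithin 2 (fun g => h (g ^ 2)) (Icc (0 : ℝ) γ) 0 with hd2
  set d3 := iteratedDerivWithin 3 (fun g => h (g ^ 2)) (Icc (0 : ℝ) γ) 0 with hd3
  have hcubic : ∀ g, 0 < g → g ≤ min γ (Real.sqrt s₃) →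
      |d1 * g + (d2 / 2 - b₂) * g ^ 2 + (d3 / 6) * g ^ 3| ≤ (B / 6 + Cn) * g ^ 4 := by
    intro g hg hgr
    have hgγ : g ∈ Icc (0 : ℝ) γ := ⟨hg.le, hgr.trans (min_le_left _ _)⟩
    have hg2 : g ^ 2 ≤ s₃ := by
      calc g ^ 2 ≤ (Real.sqrt s₃) ^ 2 := pow_le_pow_left₀ hg.le (hgr.trans (min_le_right _ _)) 2
        _ = s₃ := Real.sq_sqrt hs₃.le
    have t1 := hT g hgγ
    have t2 : |h (g ^ 2) - (b₀ + b₂ * g ^ 2)| ≤ Cn * (g ^ 2) ^ 2 := h373 (g ^ 2) (sq_nonneg g) hg2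
    have e : d1 * g + (d2 / 2 - b₂) * g ^ 2 + (d3 / 6) * g ^ 3
        = (h (g ^ 2) - (b₀ + b₂ * g ^ 2))
          - (h (g ^ 2) - (h ((0 : ℝ) ^ 2) + d1 * g + d2 * g ^ 2 / 2 + d3 * g ^ 3 / 6)) := by
      rw [hb0]; ring
    rw [e]
    calc _ ≤ |h (g ^ 2) - (b₀ + b₂ * g ^ 2)| + |h (g ^ 2) - (h ((0 : ℝ) ^ 2) + d1 * g + d2 * g ^ 2 / 2 + d3 * g ^ 3 / 6)| :=
          abs_sub _ _
      _ ≤ Cn * (g ^ 2) ^ 2 + B * g ^ 4 / 6 := add_le_add t2 t1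
      _ = (B / 6 + Cn) * g ^ 4 := by ring
  obtain ⟨h1, h2, h3⟩ := cubic_coeffs_zero hr hcubic
  exact ⟨hb0, h1, by linarith, by linarith⟩

/-! ## §5 A quadratic bound at 0 is a derivative within the segment -/

/-- **`|β t − β 0 − β₂·t| ≤ C·t²` on `[0, r]` ⟹ `HasDerivWithinAt β β₂ (Icc 0 r) 0`.** [folklore] -/
theorem hasDerivWithinAt_zero_of_quadBound {β : ℝ → ℝ} {β₂ C r : ℝ}
    (h : ∀ t ∈ Icc (0 : ℝ) r, |β t - β 0 - β₂ * t| ≤ C * t ^ 2) : HasDerivWithinAt β β₂ (Icc (0 : ℝ) r) 0 := by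
  rw [hasDerivWithinAt_iff_isLittleO]
  refine isLittleO_iff.mpr fun ε hε => ?_
  have hC1 : 0 < |C| + 1 := by positivity
  have hsmall : Iio (ε / (|C| + 1)) ∈ 𝓝[Icc (0 : ℝ) r] (0 : ℝ) :=
    mem_nhdsWithin_of_mem_nhds (Iio_mem_nhds (div_pos hε hC1))
  filter_upwards [self_mem_nhdsWithin, hsmall] with t ht hts
  rw [sub_zero, smul_eq_mul, Real.norm_eq_abs, Real.norm_eq_abs, abs_of_nonneg ht.1]
  have e : β t - β 0 - t * β₂ = β t - β 0 - β₂ * t := by ring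
  rw [e]
  have hts' : t * (|C| + 1) ≤ ε := by
    have := (lt_div_iff₀ hC1).mp hts
    exact this.le
  calc |β t - β 0 - β₂ * t| ≤ C * t ^ 2 := h t ht
    _ ≤ |C| * t ^ 2 := mul_le_mul_of_nonneg_right (le_abs_self C) (sq_nonneg t)
    _ ≤ (|C| + 1) * t * t := by nlinarith [ht.1, abs_nonneg C]
    _ ≤ ε * t := by nlinarith [ht.1]

/-! ## §6 The reading in g² implies the literal reading: an s-pair on `[0, s₀]` is a g-pair on `[0, √s₀]` -/

/-- **ROAD (S) ⊆ ROAD (G) (the chain rule with bounds).**  If every `h n` is `C^m` on `[0, s₀]` (`0 < s₀`) for every m with ONE bound `Mb m`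
per order (derivatives within the segment), then every `g ↦ h n (g²)` is `C^m` on `[0, √s₀]` for every m with ONE bound `Mg m` per order —
composition with the polynomial `g ↦ g²` (`[0, √s₀] → [0, s₀]`), the bounds by Mathlib's Faà di Bruno estimate
`norm_iteratedFDerivWithin_comp_le` (`‖∂^m (h ∘ f)‖ ≤ m!·C·D^m` with `C = Σ_{i≤m} |Mb i|`, `D = 1 + Σ_{i≤m} E i`, `E i` a bound of the i-th
derivative of `g ↦ g²` on the compact segment).  The converse FAILS (P2 #42c `EriceFlowEnclosureGClauseWitness`). [folklore] -/
theorem gPair_of_sqPair {h : ℕ → ℝ → ℝ} {Mb : ℕ → ℝ} {s₀ : ℝ} (hs₀ : 0 < s₀)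
    (hsm : ∀ n m : ℕ, ContDiffOn ℝ m (h n) (Icc (0 : ℝ) s₀))
    (hbd : ∀ n m : ℕ, ∀ x ∈ Icc (0 : ℝ) s₀, |iteratedDerivWithin m (h n) (Icc (0 : ℝ) s₀) x| ≤ Mb m) :
    ∃ Mg : ℕ → ℝ, (∀ n m : ℕ, ContDiffOn ℝ m (fun g => h n (g ^ 2)) (Icc (0 : ℝ) (Real.sqrt s₀))) ∧
      ∀ n m : ℕ, ∀ g ∈ Icc (0 : ℝ) (Real.sqrt s₀),
        |iteratedDerivWithin m (fun g => h n (g ^ 2)) (Icc (0 : ℝ) (Real.sqrt s₀)) g| ≤ Mg m := by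
  set γ : ℝ := Real.sqrt s₀ with hγdef
  have hγ : 0 < γ := Real.sqrt_pos.mpr hs₀
  have hγ2 : γ ^ 2 = s₀ := Real.sq_sqrt hs₀.le
  have hmaps : MapsTo (fun g : ℝ => g ^ 2) (Icc (0 : ℝ) γ) (Icc (0 : ℝ) s₀) := fun g hg =>
    ⟨sq_nonneg g, by rw [← hγ2]; exact pow_le_pow_left₀ hg.1 hg.2 2⟩
  have hpoly : ContDiff ℝ ∞ (fun g : ℝ => g ^ 2) := by fun_prop
  have hmtop : ∀ m : ℕ, (m : ℕ∞ω) ≤ ∞ := fun m => by exact_mod_cast le_top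
  have hsq : ∀ m : ℕ, ContDiffOn ℝ m (fun g : ℝ => g ^ 2) (Icc (0 : ℝ) γ) := fun m => (hpoly.of_le (hmtop m)).contDiffOn
  -- one bound per order for the inner map on the compact segment
  have hE : ∀ i : ℕ, ∃ E : ℝ, 0 ≤ E ∧ ∀ g ∈ Icc (0 : ℝ) γ,
      ‖iteratedFDerivWithin ℝ i (fun g : ℝ => g ^ 2) (Icc (0 : ℝ) γ) g‖ ≤ E := by
    intro i
    have hc : Continuous (iteratedDeriv i (fun g : ℝ => g ^ 2)) := ContDiff.continuous_iteratedDeriv i hpoly (hmtop i)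
    obtain ⟨E, hEb⟩ := isCompact_Icc.exists_bound_of_continuousOn (hc.continuousOn (s := Icc (0 : ℝ) γ))
    refine ⟨max E 0, le_max_right _ _, fun g hg => ?_⟩
    rw [norm_iteratedFDerivWithin_eq_norm_iteratedDerivWithin,
      iteratedDerivWithin_eq_iteratedDeriv (uniqueDiffOn_Icc hγ) ((hpoly.of_le (hmtop i)).contDiffAt) hg]
    exact (hEb g hg).trans (le_max_left _ _)
  choose E hE0 hEb using hE
  refine ⟨fun m => m ! * (∑ i ∈ Finset.range (m + 1), |Mb i|) * (1 + ∑ i ∈ Finset.range (m + 1), E i) ^ m,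
    fun n m => ?_, fun n m g hg => ?_⟩
  · have hc := (hsm n m).comp (hsq m) hmaps
    simpa only [Function.comp_def] using hc
  · have hD1 : 1 ≤ 1 + ∑ i ∈ Finset.range (m + 1), E i := by
      have : 0 ≤ ∑ i ∈ Finset.range (m + 1), E i := Finset.sum_nonneg fun i _ => hE0 i
      linarith
    have key := norm_iteratedFDerivWithin_comp_le (g := h n) (f := fun g : ℝ => g ^ 2) (n := m) (N := (m : ℕ∞ω))
      (hsm n m) (hsq m) le_rfl (uniqueDiffOn_Icc hs₀) (uniqueDiffOn_Icc hγ) hmaps hg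
      (C := ∑ i ∈ Finset.range (m + 1), |Mb i|) (D := 1 + ∑ i ∈ Finset.range (m + 1), E i)
      (fun i hi => by
        rw [norm_iteratedFDerivWithin_eq_norm_iteratedDerivWithin, Real.norm_eq_abs]
        calc |iteratedDerivWithin i (h n) (Icc (0 : ℝ) s₀) (g ^ 2)| ≤ Mb i := hbd n i (g ^ 2) (hmaps hg)
          _ ≤ |Mb i| := le_abs_self _
          _ ≤ ∑ j ∈ Finset.range (m + 1), |Mb j| :=
              Finset.single_le_sum (f := fun j => |Mb j|) (fun j _ => abs_nonneg _)
                (Finset.mem_range.mpr (Nat.lt_succ_of_le hi)))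
      (fun i hi1 hi => by
        calc ‖iteratedFDerivWithin ℝ i (fun g : ℝ => g ^ 2) (Icc (0 : ℝ) γ) g‖ ≤ E i := hEb i g hg
          _ ≤ ∑ j ∈ Finset.range (m + 1), E j :=
              Finset.single_le_sum (f := E) (fun j _ => hE0 j) (Finset.mem_range.mpr (Nat.lt_succ_of_le hi))
          _ ≤ 1 + ∑ j ∈ Finset.range (m + 1), E j := by linarith
          _ ≤ (1 + ∑ j ∈ Finset.range (m + 1), E j) ^ i := le_self_pow₀ hD1 (by omega))
    rw [← Real.norm_eq_abs, ← norm_iteratedFDerivWithin_eq_norm_iteratedDerivWithin]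
    simpa only [Function.comp_def] using key

end

end Summit.QuantumFields.BalabanUV.Beta.EriceFlowEnclosureGClauseCalc
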